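import Summits.NavierStokesRegularity.NavierStokesRegularity.Theorems.AxisymmetricExtremalityAxisymmetricKatoGlobalStubSeregin2020TypeIILemma22AcrossAxisTools
import HarnessLib

/-!
# L22-B, piece F3c (3/·): expansion of the per-piece inequality for an excised test function

Seregin 2020 Lemma 2.2 ⇐ N–U 2012 Lemma 4.2 for the class `𝒱` (cell ns-inputs, kit A1-L22B-F3,
route P).  On a time piece the energy inequality is applied to the excised test function
`Ψ = Θ·φ` (`φ` the product cut-off of the active balls).  This file expands the four source terms
of that inequality in `Θ` and `φ`:
* `‖∇(Θφ)‖² ≤ (1+σ) φ²‖∇Θ‖² + (1+σ⁻¹) Θ²‖∇φ‖²` (Young with a free `σ > 0`, sent to `0⁺` after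
  `ε → 0` by `energy_limit_of_cut_approximants`);
* `⟪Ũ, ∇(Θφ)²⟫ = φ²⟪Ũ, ∇Θ²⟫ + ⟪Ũ, Θ² ∇φ²⟫`, `D(Θφ)²·e_ϱ = φ² DΘ²·e_ϱ + Θ² Dφ²·e_ϱ`
  (`gradient_cutoffProduct_sq`, `fderiv_cutoffProduct_sq_apply`), the `φ`-derivative parts bounded
  by the absolute integrals of kit F3b.4 (e2), (e3);
so that `pieceEnergy_expanded` turns the per-piece inequality (`pieceEnergy_real`) into
"main parts (those of `Θ`, weighted by `φ² ≤ 1`) + the three excision error integrals (e1)–(e3)".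
Pure calculus and Bochner-integral bookkeeping over an arbitrary measure.
[cite: NazarovUraltseva2012, §3 (3.9), Remark 9]

Nothing here is a Navier–Stokes regularity statement.
-/

noncomputable section

set_option linter.dupNamespace false

open MeasureTheory Set Function Filter Topology TopologicalSpace Metric
open scoped NNReal ENNReal InnerProductSpace RealInnerProductSpace

namespace Summit.NavierStokesRegularity.NavierStokesRegularity.Theorems.AxisymmetricKatoGlobal.EulerScaling

open Literature.Analysis.FluidPDE Literature.Analysis.FluidPDE.Seregin2020

/-- **Young splitting of `‖∇(Θφ)‖²`.** For `C¹` functions `Θ, φ` and `σ > 0`: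
`‖∇(Θφ)(x)‖² ≤ (1+σ) φ(x)²‖∇Θ(x)‖² + (1+σ⁻¹) Θ(x)²‖∇φ(x)‖²`. [folklore] -/
theorem norm_gradient_mul_sq_le {Θ φ : EuclideanSpace ℝ (Fin 3) → ℝ} (hΘ : ContDiff ℝ 1 Θ) (hφ : ContDiff ℝ 1 φ)
    {σ : ℝ} (hσ : 0 < σ) (x : EuclideanSpace ℝ (Fin 3)) :
    ‖gradient (fun y => Θ y * φ y) x‖ ^ 2 ≤
      (1 + σ) * (φ x ^ 2 * ‖gradient Θ x‖ ^ 2) + (1 + σ⁻¹) * (Θ x ^ 2 * ‖gradient φ x‖ ^ 2) := by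
  have hdΘ : DifferentiableAt ℝ Θ x := hΘ.differentiable one_ne_zero x
  have hdφ : DifferentiableAt ℝ φ x := hφ.differentiable one_ne_zero x
  rw [gradient_mul_apply' hdΘ hdφ]
  set u : EuclideanSpace ℝ (Fin 3) := Θ x • gradient φ x with hu
  set v : EuclideanSpace ℝ (Fin 3) := φ x • gradient Θ x with hv
  have hnu : ‖u‖ ^ 2 = Θ x ^ 2 * ‖gradient φ x‖ ^ 2 := by
    rw [hu, norm_smul, Real.norm_eq_abs, mul_pow, sq_abs]
  have hnv : ‖v‖ ^ 2 = φ x ^ 2 * ‖gradient Θ x‖ ^ 2 := by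
    rw [hv, norm_smul, Real.norm_eq_abs, mul_pow, sq_abs]
  have htri : ‖u + v‖ ≤ ‖u‖ + ‖v‖ := norm_add_le u v
  have hsq : ‖u + v‖ ^ 2 ≤ (‖u‖ + ‖v‖) ^ 2 := pow_le_pow_left₀ (norm_nonneg _) htri 2
  have hyoung : 2 * ‖v‖ * ‖u‖ ≤ σ * ‖v‖ ^ 2 + σ⁻¹ * ‖u‖ ^ 2 := by
    have key : σ * ‖v‖ ^ 2 + σ⁻¹ * ‖u‖ ^ 2 - 2 * ‖v‖ * ‖u‖ = σ⁻¹ * (σ * ‖v‖ - ‖u‖) ^ 2 := by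
      field_simp
      ring
    nlinarith [mul_nonneg (inv_nonneg.2 hσ.le) (sq_nonneg (σ * ‖v‖ - ‖u‖))]
  rw [← hnu, ← hnv]
  nlinarith [norm_nonneg u, norm_nonneg v]

/-- **Expansion of the per-piece inequality.** Let `L ≤ Ma + 4∫ηH(Φ̃)‖∇Ψ‖² + ∫ηH(Φ̃)⟪Ũ,∇Ψ²⟫ +
∫η(2/ϱ)H(Φ̃)DΨ²·e_ϱ + T4` be the per-piece energy inequality for the excised test function
`Ψ = Θφ` (any measure `μ`; `H, η ≥ 0`; `Θ, φ ∈ C¹`; `σ > 0`).  Given integrability of the six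
expanded integrands (the three "main parts" and the three excision-error integrands of kit F3b.4),
`L ≤ Ma + (1+σ)·4∫ηH φ²‖∇Θ‖² + (1+σ⁻¹)·4∫ηH Θ²‖∇φ‖² + ∫ηH φ²⟪Ũ,∇Θ²⟫ + ∫ηH|⟪Ũ, Θ²∇φ²⟫|
 + ∫η(2/ϱ)H φ² DΘ²·e_ϱ + ∫η(2/ϱ)H |Θ² Dφ²·e_ϱ| + T4`. [cite: NazarovUraltseva2012, §3 Remark 9] -/
theorem pieceEnergy_expanded {μ : Measure (ℝ × EuclideanSpace ℝ (Fin 3))}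
    {Φ' : ℝ → EuclideanSpace ℝ (Fin 3) → ℝ} {U' : ℝ → EuclideanSpace ℝ (Fin 3) → EuclideanSpace ℝ (Fin 3)}
    {H : ℝ → ℝ} (hH0 : ∀ v, 0 ≤ H v)
    {Θ φ : EuclideanSpace ℝ (Fin 3) → ℝ} (hΘ : ContDiff ℝ 1 Θ) (hφ : ContDiff ℝ 1 φ)
    {η : ℝ → ℝ} (hη0 : ∀ s, 0 ≤ η s) {σ : ℝ} (hσ : 0 < σ) {L Ma T4 : ℝ}
    (iA : Integrable (fun w : ℝ × EuclideanSpace ℝ (Fin 3) =>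
      η w.1 * (H (Φ' w.1 w.2) * (φ w.2 ^ 2 * ‖gradient Θ w.2‖ ^ 2))) μ)
    (iB : Integrable (fun w : ℝ × EuclideanSpace ℝ (Fin 3) =>
      η w.1 * (H (Φ' w.1 w.2) * (Θ w.2 ^ 2 * ‖gradient φ w.2‖ ^ 2))) μ)
    (iC : Integrable (fun w : ℝ × EuclideanSpace ℝ (Fin 3) =>
      η w.1 * (H (Φ' w.1 w.2) * (φ w.2 ^ 2 * inner ℝ (U' w.1 w.2) (gradient (fun y => Θ y ^ 2) w.2)))) μ)
    (iD : Integrable (fun w : ℝ × EuclideanSpace ℝ (Fin 3) =>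
      η w.1 * (H (Φ' w.1 w.2) * inner ℝ (U' w.1 w.2) ((Θ w.2 ^ 2) • gradient (fun y => φ y ^ 2) w.2))) μ)
    (iE : Integrable (fun w : ℝ × EuclideanSpace ℝ (Fin 3) =>
      η w.1 * (2 / cylRadius w.2 * (H (Φ' w.1 w.2) * (φ w.2 ^ 2 * fderiv ℝ (fun y => Θ y ^ 2) w.2 (eR w.2))))) μ)
    (iF : Integrable (fun w : ℝ × EuclideanSpace ℝ (Fin 3) =>
      η w.1 * (2 / cylRadius w.2 * (H (Φ' w.1 w.2) * (Θ w.2 ^ 2 * fderiv ℝ (fun y => φ y ^ 2) w.2 (eR w.2))))) μ)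
    (hpiece : L ≤ Ma +
      (4 * ∫ w, η w.1 * (H (Φ' w.1 w.2) * ‖gradient (fun x => Θ x * φ x) w.2‖ ^ 2) ∂μ) +
      (∫ w, η w.1 * (H (Φ' w.1 w.2) * inner ℝ (U' w.1 w.2) (gradient (fun y => (Θ y * φ y) ^ 2) w.2)) ∂μ) +
      (∫ w, η w.1 * (2 / cylRadius w.2 * (H (Φ' w.1 w.2) * fderiv ℝ (fun y => (Θ y * φ y) ^ 2) w.2 (eR w.2))) ∂μ) +
      T4) :
    L ≤ Ma +
      (1 + σ) * (4 * ∫ w, η w.1 * (H (Φ' w.1 w.2) * (φ w.2 ^ 2 * ‖gradient Θ w.2‖ ^ 2)) ∂μ) +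
      (1 + σ⁻¹) * (4 * ∫ w, η w.1 * (H (Φ' w.1 w.2) * (Θ w.2 ^ 2 * ‖gradient φ w.2‖ ^ 2)) ∂μ) +
      (∫ w, η w.1 * (H (Φ' w.1 w.2) * (φ w.2 ^ 2 * inner ℝ (U' w.1 w.2) (gradient (fun y => Θ y ^ 2) w.2))) ∂μ) +
      (∫ w, η w.1 * (H (Φ' w.1 w.2) * |inner ℝ (U' w.1 w.2) ((Θ w.2 ^ 2) • gradient (fun y => φ y ^ 2) w.2)|) ∂μ) +
      (∫ w, η w.1 * (2 / cylRadius w.2 * (H (Φ' w.1 w.2) *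
        (φ w.2 ^ 2 * fderiv ℝ (fun y => Θ y ^ 2) w.2 (eR w.2)))) ∂μ) +
      (∫ w, η w.1 * (2 / cylRadius w.2 * (H (Φ' w.1 w.2) *
        |Θ w.2 ^ 2 * fderiv ℝ (fun y => φ y ^ 2) w.2 (eR w.2)|)) ∂μ) +
      T4 := by
  -- ### the gradient term
  have hT1 : (∫ w, η w.1 * (H (Φ' w.1 w.2) * ‖gradient (fun x => Θ x * φ x) w.2‖ ^ 2) ∂μ) ≤
      (1 + σ) * (∫ w, η w.1 * (H (Φ' w.1 w.2) * (φ w.2 ^ 2 * ‖gradient Θ w.2‖ ^ 2)) ∂μ) +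
      (1 + σ⁻¹) * (∫ w, η w.1 * (H (Φ' w.1 w.2) * (Θ w.2 ^ 2 * ‖gradient φ w.2‖ ^ 2)) ∂μ) := by
    rw [← integral_const_mul, ← integral_const_mul, ← integral_add (iA.const_mul _) (iB.const_mul _)]
    refine integral_mono_of_nonneg (Eventually.of_forall fun w => ?_) ((iA.const_mul _).add (iB.const_mul _))
      (Eventually.of_forall fun w => ?_)
    · exact mul_nonneg (hη0 _) (mul_nonneg (hH0 _) (sq_nonneg _))
    · have h := norm_gradient_mul_sq_le hΘ hφ hσ w.2
      have hc : 0 ≤ η w.1 * H (Φ' w.1 w.2) := mul_nonneg (hη0 _) (hH0 _)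
      have := mul_le_mul_of_nonneg_left h hc
      nlinarith [this]
  -- ### the drift term
  have hT2 : (∫ w, η w.1 * (H (Φ' w.1 w.2) * inner ℝ (U' w.1 w.2) (gradient (fun y => (Θ y * φ y) ^ 2) w.2)) ∂μ) =
      (∫ w, η w.1 * (H (Φ' w.1 w.2) * (φ w.2 ^ 2 * inner ℝ (U' w.1 w.2) (gradient (fun y => Θ y ^ 2) w.2))) ∂μ) +
      ∫ w, η w.1 * (H (Φ' w.1 w.2) * inner ℝ (U' w.1 w.2) ((Θ w.2 ^ 2) • gradient (fun y => φ y ^ 2) w.2)) ∂μ := by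
    rw [← integral_add iC iD]
    refine integral_congr_ae (Eventually.of_forall fun w => ?_)
    beta_reduce
    rw [gradient_cutoffProduct_sq hΘ hφ, inner_add_right, real_inner_smul_right]
    ring
  have hT2b : (∫ w, η w.1 * (H (Φ' w.1 w.2) * inner ℝ (U' w.1 w.2) ((Θ w.2 ^ 2) • gradient (fun y => φ y ^ 2) w.2)) ∂μ) ≤
      ∫ w, η w.1 * (H (Φ' w.1 w.2) * |inner ℝ (U' w.1 w.2) ((Θ w.2 ^ 2) • gradient (fun y => φ y ^ 2) w.2)|) ∂μ := by
    have habs : (fun w : ℝ × EuclideanSpace ℝ (Fin 3) =>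
        η w.1 * (H (Φ' w.1 w.2) * |inner ℝ (U' w.1 w.2) ((Θ w.2 ^ 2) • gradient (fun y => φ y ^ 2) w.2)|)) =
        fun w => ‖η w.1 * (H (Φ' w.1 w.2) * inner ℝ (U' w.1 w.2) ((Θ w.2 ^ 2) • gradient (fun y => φ y ^ 2) w.2))‖ := by
      funext w
      rw [Real.norm_eq_abs, abs_mul, abs_mul, abs_of_nonneg (hη0 _), abs_of_nonneg (hH0 _)]
    rw [habs]
    exact (le_abs_self _).trans (by rw [← Real.norm_eq_abs]; exact norm_integral_le_integral_norm _)
  -- ### the axis term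
  have hT3 : (∫ w, η w.1 * (2 / cylRadius w.2 * (H (Φ' w.1 w.2) * fderiv ℝ (fun y => (Θ y * φ y) ^ 2) w.2 (eR w.2))) ∂μ) =
      (∫ w, η w.1 * (2 / cylRadius w.2 * (H (Φ' w.1 w.2) * (φ w.2 ^ 2 * fderiv ℝ (fun y => Θ y ^ 2) w.2 (eR w.2)))) ∂μ) +
      ∫ w, η w.1 * (2 / cylRadius w.2 * (H (Φ' w.1 w.2) * (Θ w.2 ^ 2 * fderiv ℝ (fun y => φ y ^ 2) w.2 (eR w.2)))) ∂μ := by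
    rw [← integral_add iE iF]
    refine integral_congr_ae (Eventually.of_forall fun w => ?_)
    beta_reduce
    rw [fderiv_cutoffProduct_sq_apply hΘ hφ]
    ring
  have hT3b : (∫ w, η w.1 * (2 / cylRadius w.2 * (H (Φ' w.1 w.2) *
        (Θ w.2 ^ 2 * fderiv ℝ (fun y => φ y ^ 2) w.2 (eR w.2)))) ∂μ) ≤
      ∫ w, η w.1 * (2 / cylRadius w.2 * (H (Φ' w.1 w.2) *
        |Θ w.2 ^ 2 * fderiv ℝ (fun y => φ y ^ 2) w.2 (eR w.2)|)) ∂μ := by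
    have habs : (fun w : ℝ × EuclideanSpace ℝ (Fin 3) => η w.1 * (2 / cylRadius w.2 * (H (Φ' w.1 w.2) *
        |Θ w.2 ^ 2 * fderiv ℝ (fun y => φ y ^ 2) w.2 (eR w.2)|))) =
        fun w => ‖η w.1 * (2 / cylRadius w.2 * (H (Φ' w.1 w.2) *
          (Θ w.2 ^ 2 * fderiv ℝ (fun y => φ y ^ 2) w.2 (eR w.2))))‖ := by
      funext w
      have hρ : 0 ≤ 2 / cylRadius w.2 := div_nonneg zero_le_two (cylRadius_nonneg _)
      rw [Real.norm_eq_abs, abs_mul (η w.1), abs_mul (2 / cylRadius w.2), abs_mul (H (Φ' w.1 w.2)),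
        abs_of_nonneg (hη0 _), abs_of_nonneg hρ, abs_of_nonneg (hH0 _)]
    rw [habs]
    exact (le_abs_self _).trans (by rw [← Real.norm_eq_abs]; exact norm_integral_le_integral_norm _)
  rw [hT2, hT3] at hpiece
  nlinarith [hT1, hT2b, hT3b]

end Summit.NavierStokesRegularity.NavierStokesRegularity.Theorems.AxisymmetricKatoGlobal.EulerScaling

end
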